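import Mathlib
import HarnessLib
import Summits.HubbardSuperconductivity.HubbardSuperconductivity.Theorems.KLProgrammeKLRegimeEnginePairTransferSmearingBinomial
import Summits.HubbardSuperconductivity.HubbardSuperconductivity.Theorems.KLProgrammeKLRegimeEnginePairTransferMemberConservation
import Summits.HubbardSuperconductivity.HubbardSuperconductivity.Theorems.KLProgrammeKLRegimeEnginePairTransferMemberResolvedDefect

/-!
# Route `KLProgramme` — ENGINE child gen 8 (stmt-HubbardSuperconductivity-20437 `KLRegimeEngineV17F2`), skeleton v2 class #5 rev 3: the ξΔ door's KERNEL-DIFFERENCE inputs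
# from binomial–Gram data — `klmd_vertexFn_gaussConv_sub_le_binomial`, **`klmd_kernelDiff4_le_binomial`**, **`klmd_kernelDiff6_le_binomial`**, **`klmd_selfEnergyDiff_le_binomial`**
# (cell gate-hubbard-kl, seat hubbard-kl-k3c1-p1 g13, technique «composed-map remainder propagation»; the `(e^{Δ_{S_D}} − 1)` remainder propagated through the member pins)

WHY.  Four of the nine rows of the ξΔ door `klmd_defectDiff_le_rows` (`Rd₂ Rx₂ R6₂ Rl₂`) are member-2 weights against DIFFERENCES of the two members' kernels
`V₁V₁ − V₂V₂`, `V6₁Sg₁ − V6₂Sg₂`, and the localisation products; by `‖a₁b₁ − a₂b₂‖ ≤ ‖a₁ − a₂‖‖b₁‖ + ‖a₂‖‖b₁ − b₂‖` they reduce to the a priori kernel sups and ONE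
smearing-Lipschitz number per degree: `‖V₁ t X − V₂ t X‖`, `‖V6₁ t X − V6₂ t X‖`, `‖Sg₁ t p σ − Sg₂ t p σ‖`.  The two carriers differ EXACTLY by `(e^{Δ_{S_D}} − 1)` on the
second (`klmf_vertexFn_carrier_sub_eq`, `S_D = softCovOf K (ψ₁ − ψ₂)`), and the Literature binomial–Gram bound (BGM 2006 (2.61)–(2.66),
`sum_norm_kernel_gaussConv_sub_le_binomial_of_gramBounded`) controls `e^{Δ_C}H − H` from a Gram constant of `C` and the pinned norms of `H`'s higher kernels.  This file:
* `klmd_vertexFn_gaussConv_sub_le_binomial` — the pointwise vertex-function form in every degree `2p`, `0 < p` (the tree's `klmf_…` is `p = 2`);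
* **`klmd_kernelDiff4_le_binomial`** / **`klmd_kernelDiff6_le_binomial`** / **`klmd_selfEnergyDiff_le_binomial`** — keyed on the member pins of
  `klmd_pinnedDefect_eq_resolved` (two members `ψ₁ ψ₂`, frame `K`, slice `n+1`, time `t`): from `IsGramBoundedR (softCovOf K (ψ₁ − ψ₂)) κ` and the pinned kernel norms
  `N(m′)` of the member-2 carrier `e^{Δ_{S_{ψ₂} + C_{>Λ_{n+1}} − C_{>Λ(t)}}}𝒢^K_{Λ(t)}` (even by `klmc_carrier_mem_evenOdd_zero`):
  `‖V₁ t X − V₂ t X‖ ≤ (4!·|βL²|³)·Σ_{m′>2} C(2m′,4)κ^{2m′−4}N(m′)`, `‖V6₁ t X − V6₂ t X‖ ≤ (6!·|βL²|⁵)·Σ_{m′>3} C(2m′,6)κ^{2m′−6}N(m′)`,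
  `‖Sg₁ t p σ − Sg₂ t p σ‖ ≤ (2!·|βL²|)·Σ_{m′>1} C(2m′,2)κ^{2m′−2}N(m′)` — the same currency as the BASE (`klmf_baseData_of_binomial`, row 28): a MASS-sensitive Gram
  constant of the `D`-line (`κ² ∝ Λₙ·klIdxMass n j′` for the family pair) and class-#1 kernel norms along the slice.
Composition over landed lemmas; nothing about the model's sizes is asserted; nothing asserts (X).3, (c), K3 or superconductivity.  0 kit · 0 lit.
-/

noncomputable section

namespace Summit.HubbardSuperconductivity.HubbardSuperconductivity.Theorems.KLRegimeSplit

set_option linter.dupNamespace false -- summit = problem name (single-conjunct summit), D-0017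

open Finset Matrix Set Literature.MathematicalPhysics.QuantumLattice Literature.Probability.LatticeModels GrassmannAlgebra
open Summit.HubbardSuperconductivity.HubbardSuperconductivity.Theorems.KLProgrammeLegKernels
open Summit.HubbardSuperconductivity.HubbardSuperconductivity.Theorems.TwoPointAssembly
open Summit.HubbardSuperconductivity.HubbardSuperconductivity.Theorems.DispersionFlow
open Summit.HubbardSuperconductivity.HubbardSuperconductivity.Theorems.KLRegimeWick
open Summit.HubbardSuperconductivity.HubbardSuperconductivity.Theorems.EngineV8

/-! ## §1 The binomial–Gram smearing bound, pointwise, every even degree -/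

section Generic

variable (L M : ℕ) [NeZero L] (β : ℝ)

/-- **Pointwise vertex-function form of the binomial–Gram smearing bound in degree `2p`** (`0 < p`): for even `H`, `IsGramBoundedR D κ`, pinned kernel norms `N`:
`‖𝒱_{2p}(e^{Δ_D}H − H)(X)‖ ≤ ((2p)!·|βL²|^{2p−1})·Σ_{m′} [p < m′]·C(2m′, 2p)·κ^{2m′−2p}·N(m′)` (`p = 2`: `klmf_vertexFn_gaussConv_sub_le_binomial`). -/
theorem klmd_vertexFn_gaussConv_sub_le_binomial {D : Matrix (HubbardFieldIdx L M) (HubbardFieldIdx L M) ℂ} {κ : ℝ} (hκ : 0 ≤ κ)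
    (hGB : IsGramBoundedR D κ) (H : HubbardGrassmann L M) (hH : H ∈ evenPart ℂ (HubbardFieldIdx L M)) (N : ℕ → ℝ) (hN0 : ∀ m', 0 ≤ N m')
    (hN : ∀ m' (j : Fin (2 * m')) (w : HubbardFieldIdx L M),
      ∑ Y ∈ univ.filter (fun Y : Fin (2 * m') → HubbardFieldIdx L M => Y j = w), ‖kernel ℂ H (2 * m') Y‖ ≤ N m')
    {p : ℕ} (hp : 0 < p) (X : Fin (2 * p) → HubbardFieldIdx L M) :
    ‖vertexFn L M β (gaussConv ℂ D H - H) (2 * p) X‖ ≤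
      (((2 * p).factorial : ℝ) * |β * (L : ℝ) ^ 2| ^ (2 * p - 1)) *
        ∑ m' ∈ range (Fintype.card (HubbardFieldIdx L M) / 2 + 1), if p < m' then ((2 * m').choose (2 * p) : ℝ) * κ ^ (2 * m' - 2 * p) * N m' else 0 := by
  have h0 : 0 < 2 * p := by omega
  have hsum := sum_norm_kernel_gaussConv_sub_le_binomial_of_gramBounded (𝕜 := ℂ) D hκ hGB H hH N hN0 hN (p := p) (⟨0, h0⟩ : Fin (2 * p)) (X ⟨0, h0⟩)
  have hsingle : ‖kernel ℂ (gaussConv ℂ D H - H) (2 * p) X‖ ≤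
      ∑ W ∈ univ.filter (fun W : Fin (2 * p) → HubbardFieldIdx L M => W ⟨0, h0⟩ = X ⟨0, h0⟩), ‖kernel ℂ (gaussConv ℂ D H - H) (2 * p) W‖ :=
    single_le_sum (f := fun W => ‖kernel ℂ (gaussConv ℂ D H - H) (2 * p) W‖) (fun W _ => norm_nonneg _) (by simp)
  rw [vertexFn_def, norm_mul, Complex.norm_real, Real.norm_eq_abs, abs_mul, abs_pow, Nat.abs_cast]
  exact mul_le_mul_of_nonneg_left (hsingle.trans hsum) (by positivity)

end Generic

/-! ## §2 Keyed on the member pins: the three kernel differences -/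

section Members

variable (L M : ℕ) [NeZero L] (β U μ : ℝ) (K : TrigPolyC4v)

/-- **`klmd_kernelDiff4_le_binomial`** — the 4-point kernel difference of the two members at time `t`: with `V₁ V₂` the pins of `klmd_pinnedDefect_eq_resolved` (pass `rfl`),
`IsGramBoundedR (softCovOf K (ψ₁ − ψ₂)) κ` and the pinned kernel norms `N` of the member-2 carrier at `Λ(t)`: `‖V₁ t X − V₂ t X‖ ≤ (4!·|βL²|³)·Σ_{m′>2} C(2m′,4)κ^{2m′−4}N(m′)`. -/
theorem klmd_kernelDiff4_le_binomial (n : ℕ) (ψ₁ ψ₂ : FreqMomentum L M → ℝ)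
    (V₁ : ℝ → (Fin 4 → HubbardFieldIdx L M) → ℂ) (hV₁ : V₁ = fun t X => vertexFn L M β (gaussConv ℂ (softCovOf L M β μ K ψ₁ + hubbardCovAboveCT L M β μ 0 K (klScale klE0 (n + 1)) -
            hubbardCovAboveCT L M β μ 0 K (klScale klE0 n + t * (klScale klE0 (n + 1) - klScale klE0 n))) (hubbardEffectiveActionCT L M β U μ 0 K (klScale klE0 n + t * (klScale klE0 (n
            + 1) - klScale klE0 n)))) 4 X)
    (V₂ : ℝ → (Fin 4 → HubbardFieldIdx L M) → ℂ) (hV₂ : V₂ = fun t X => vertexFn L M β (gaussConv ℂ (softCovOf L M β μ K ψ₂ + hubbardCovAboveCT L M β μ 0 K (klScale klE0 (n + 1)) -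
            hubbardCovAboveCT L M β μ 0 K (klScale klE0 n + t * (klScale klE0 (n + 1) - klScale klE0 n))) (hubbardEffectiveActionCT L M β U μ 0 K (klScale klE0 n + t * (klScale klE0 (n
            + 1) - klScale klE0 n)))) 4 X)
    {κ : ℝ} (hκ : 0 ≤ κ) (hGB : IsGramBoundedR (softCovOf L M β μ K (ψ₁ - ψ₂)) κ) (t : ℝ)
    (N : ℕ → ℝ) (hN0 : ∀ m', 0 ≤ N m')
    (hN : ∀ m' (i : Fin (2 * m')) (w : HubbardFieldIdx L M),
      ∑ Y ∈ univ.filter (fun Y : Fin (2 * m') → HubbardFieldIdx L M => Y i = w), ‖kernel ℂ (gaussConv ℂ (softCovOf L M β μ K ψ₂ + hubbardCovAboveCT L M β μ 0 K (klScale klE0 (n + 1)) -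
              hubbardCovAboveCT L M β μ 0 K (klScale klE0 n + t * (klScale klE0 (n + 1) - klScale klE0 n))) (hubbardEffectiveActionCT L M β U μ 0 K (klScale klE0 n + t * (klScale klE0
              (n + 1) - klScale klE0 n)))) (2 * m') Y‖ ≤ N m') (X : Fin 4 → HubbardFieldIdx L M) :
    ‖V₁ t X - V₂ t X‖ ≤
      (((2 * 2).factorial : ℝ) * |β * (L : ℝ) ^ 2| ^ (2 * 2 - 1)) *
        ∑ m' ∈ range (Fintype.card (HubbardFieldIdx L M) / 2 + 1), if 2 < m' then ((2 * m').choose (2 * 2) : ℝ) * κ ^ (2 * m' - 2 * 2) * N m' else 0 := by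
  subst hV₁ hV₂
  dsimp only
  rw [klmf_vertexFn_carrier_sub_eq]
  exact klmd_vertexFn_gaussConv_sub_le_binomial L M β hκ hGB _ ((mem_evenPart_iff).2 (klmc_carrier_mem_evenOdd_zero β U μ K _ _)) N hN0 hN
    (p := 2) (by norm_num) X

/-- **`klmd_kernelDiff6_le_binomial`** — the same for the 6-point pins `V6₁ V6₂`: `‖V6₁ t X − V6₂ t X‖ ≤ (6!·|βL²|⁵)·Σ_{m′>3} C(2m′,6)κ^{2m′−6}N(m′)`. -/
theorem klmd_kernelDiff6_le_binomial (n : ℕ) (ψ₁ ψ₂ : FreqMomentum L M → ℝ)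
    (V6₁ : ℝ → (Fin 6 → HubbardFieldIdx L M) → ℂ) (hV6₁ : V6₁ = fun t X => vertexFn L M β (gaussConv ℂ (softCovOf L M β μ K ψ₁ + hubbardCovAboveCT L M β μ 0 K (klScale klE0 (n + 1)) -
            hubbardCovAboveCT L M β μ 0 K (klScale klE0 n + t * (klScale klE0 (n + 1) - klScale klE0 n))) (hubbardEffectiveActionCT L M β U μ 0 K (klScale klE0 n + t * (klScale klE0 (n
            + 1) - klScale klE0 n)))) 6 X)
    (V6₂ : ℝ → (Fin 6 → HubbardFieldIdx L M) → ℂ) (hV6₂ : V6₂ = fun t X => vertexFn L M β (gaussConv ℂ (softCovOf L M β μ K ψ₂ + hubbardCovAboveCT L M β μ 0 K (klScale klE0 (n + 1)) -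
            hubbardCovAboveCT L M β μ 0 K (klScale klE0 n + t * (klScale klE0 (n + 1) - klScale klE0 n))) (hubbardEffectiveActionCT L M β U μ 0 K (klScale klE0 n + t * (klScale klE0 (n
            + 1) - klScale klE0 n)))) 6 X)
    {κ : ℝ} (hκ : 0 ≤ κ) (hGB : IsGramBoundedR (softCovOf L M β μ K (ψ₁ - ψ₂)) κ) (t : ℝ)
    (N : ℕ → ℝ) (hN0 : ∀ m', 0 ≤ N m')
    (hN : ∀ m' (i : Fin (2 * m')) (w : HubbardFieldIdx L M),
      ∑ Y ∈ univ.filter (fun Y : Fin (2 * m') → HubbardFieldIdx L M => Y i = w), ‖kernel ℂ (gaussConv ℂ (softCovOf L M β μ K ψ₂ + hubbardCovAboveCT L M β μ 0 K (klScale klE0 (n + 1)) -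
              hubbardCovAboveCT L M β μ 0 K (klScale klE0 n + t * (klScale klE0 (n + 1) - klScale klE0 n))) (hubbardEffectiveActionCT L M β U μ 0 K (klScale klE0 n + t * (klScale klE0
              (n + 1) - klScale klE0 n)))) (2 * m') Y‖ ≤ N m') (X : Fin 6 → HubbardFieldIdx L M) :
    ‖V6₁ t X - V6₂ t X‖ ≤
      (((2 * 3).factorial : ℝ) * |β * (L : ℝ) ^ 2| ^ (2 * 3 - 1)) *
        ∑ m' ∈ range (Fintype.card (HubbardFieldIdx L M) / 2 + 1), if 3 < m' then ((2 * m').choose (2 * 3) : ℝ) * κ ^ (2 * m' - 2 * 3) * N m' else 0 := by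
  subst hV6₁ hV6₂
  dsimp only
  rw [klmf_vertexFn_carrier_sub_eq]
  exact klmd_vertexFn_gaussConv_sub_le_binomial L M β hκ hGB _ ((mem_evenPart_iff).2 (klmc_carrier_mem_evenOdd_zero β U μ K _ _)) N hN0 hN
    (p := 3) (by norm_num) X

/-- **`klmd_selfEnergyDiff_le_binomial`** — the same for the self-energy pins `Sg₁ Sg₂` (`selfEnergy = 𝒱₂` on the diagonal labels):
`‖Sg₁ t p σ − Sg₂ t p σ‖ ≤ (2!·|βL²|)·Σ_{m′>1} C(2m′,2)κ^{2m′−2}N(m′)`. -/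
theorem klmd_selfEnergyDiff_le_binomial (n : ℕ) (ψ₁ ψ₂ : FreqMomentum L M → ℝ)
    (Sg₁ : ℝ → FreqMomentum L M → Fin 2 → ℂ) (hSg₁ : Sg₁ = fun t p σ => selfEnergy L M β (gaussConv ℂ (softCovOf L M β μ K ψ₁ + hubbardCovAboveCT L M β μ 0 K (klScale klE0 (n + 1)) -
            hubbardCovAboveCT L M β μ 0 K (klScale klE0 n + t * (klScale klE0 (n + 1) - klScale klE0 n))) (hubbardEffectiveActionCT L M β U μ 0 K (klScale klE0 n + t * (klScale klE0 (n
            + 1) - klScale klE0 n)))) p σ)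
    (Sg₂ : ℝ → FreqMomentum L M → Fin 2 → ℂ) (hSg₂ : Sg₂ = fun t p σ => selfEnergy L M β (gaussConv ℂ (softCovOf L M β μ K ψ₂ + hubbardCovAboveCT L M β μ 0 K (klScale klE0 (n + 1)) -
            hubbardCovAboveCT L M β μ 0 K (klScale klE0 n + t * (klScale klE0 (n + 1) - klScale klE0 n))) (hubbardEffectiveActionCT L M β U μ 0 K (klScale klE0 n + t * (klScale klE0 (n
            + 1) - klScale klE0 n)))) p σ)
    {κ : ℝ} (hκ : 0 ≤ κ) (hGB : IsGramBoundedR (softCovOf L M β μ K (ψ₁ - ψ₂)) κ) (t : ℝ)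
    (N : ℕ → ℝ) (hN0 : ∀ m', 0 ≤ N m')
    (hN : ∀ m' (i : Fin (2 * m')) (w : HubbardFieldIdx L M),
      ∑ Y ∈ univ.filter (fun Y : Fin (2 * m') → HubbardFieldIdx L M => Y i = w), ‖kernel ℂ (gaussConv ℂ (softCovOf L M β μ K ψ₂ + hubbardCovAboveCT L M β μ 0 K (klScale klE0 (n + 1)) -
              hubbardCovAboveCT L M β μ 0 K (klScale klE0 n + t * (klScale klE0 (n + 1) - klScale klE0 n))) (hubbardEffectiveActionCT L M β U μ 0 K (klScale klE0 n + t * (klScale klE0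
              (n + 1) - klScale klE0 n)))) (2 * m') Y‖ ≤ N m') (p : FreqMomentum L M) (σ : Fin 2) :
    ‖Sg₁ t p σ - Sg₂ t p σ‖ ≤
      (((2 * 1).factorial : ℝ) * |β * (L : ℝ) ^ 2| ^ (2 * 1 - 1)) *
        ∑ m' ∈ range (Fintype.card (HubbardFieldIdx L M) / 2 + 1), if 1 < m' then ((2 * m').choose (2 * 1) : ℝ) * κ ^ (2 * m' - 2 * 1) * N m' else 0 := by
  subst hSg₁ hSg₂
  dsimp only
  rw [selfEnergy, selfEnergy, klmf_vertexFn_carrier_sub_eq]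
  exact klmd_vertexFn_gaussConv_sub_le_binomial L M β hκ hGB _ ((mem_evenPart_iff).2 (klmc_carrier_mem_evenOdd_zero β U μ K _ _)) N hN0 hN
    (p := 1) (by norm_num) _

end Members

end Summit.HubbardSuperconductivity.HubbardSuperconductivity.Theorems.KLRegimeSplit

end
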